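import Mathlib
import HarnessLib
import HarnessLib.Audit
import Summits.SmoothPoincare4.Statement
import Literature.Topology.FourManifolds.HomotopySpheres
import Literature.Topology.FourManifolds.ConnectedSum
import Literature.Topology.FourManifolds.ComplexProjectiveSpace
import Literature.Topology.FourManifolds.GluckTwist
import Literature.Topology.FourManifolds.GluckTwistUnknotProofs
import Literature.Topology.FourManifolds.KnotsProofs
import Literature.Topology.FourManifolds.ConnectedSumTransportProofs
import Literature.Topology.FourManifolds.Morse
import HarnessLib.Audit.Status.Attr

/-!
Route: RootDecompP

# Route RootDecompP — Root decomposition P (GluckLength, lens 2, gen 5) — SPC4 iff every dissolvable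
sphere is Gluck-reachable (residual), Gluck twists of Gluck twists are Gluck twists, B4, DissolveOne

ROOT DECOMPOSITION NODE, cell decomp-sp4, lens 2 (structural dichotomy: special vs generic),
generation 5 — the OR-sibling packaging (W2)
of the node GluckLength, to be used ONLY if the layer-2 split of DissolvableIsGluck
stmt-SmoothPoincare4-17709 inside
route-SmoothPoincare4-DissolvableGluck (W1) is refused to a non-tenure seat. The special class is G
= Gluck twists of S⁴ along a 2-knot;
the new axis is GLUCK LENGTH: G ⊆ G^∞ = homotopy spheres reachable from S⁴ by a finite chain of
GLUCK STEPS (twist along an embedded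
S² × ℝ² in the current homotopy sphere; Kirby Problem N4.51(A), Akbulut). It suffices to show X =
DissolveOne (#17710, pooled: every
homotopy 4-sphere dissolves after one ℂℙ²) ∧ DissolvableGluckReachable (NEW, DECLARED RESIDUAL:
dissolvable ⟹ finite Gluck length) ∧
GluckTwistOfGluckTwist (NEW, ATTACKED: G is closed under Gluck steps, so every chain collapses to
length ≤ 1) ∧ GluckTwistsStandard
(#17711, pooled: the Gluck twist conjecture B4). Kernel (decomp-sp4-lens-2/v5/GluckLength.lean, 0
sorry): DissolvableIsGluck ⟸
DissolvableGluckReachable ∧ GluckTwistOfGluckTwist UNCONDITIONALLY and ⟺ modulo the published fact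
«a Gluck step preserves
ℂℙ²-dissolvability»; HomotopySpheresAreGluckTwists #27057 ⟺ AllGluckReachable ∧
GluckTwistOfGluckTwist UNCONDITIONALLY; every piece is
S-implied (proved). Realises the spine card doubles-reflection-rung only through the pooled B4 leaf;
the two new pieces have no card.
Lean: `open scoped ContDiff in (∀ (M : Type) [TopologicalSpace M] [T2Space M]
[SecondCountableTopology M] [ChartedSpace (EuclideanSpace ℝ (Fin 4)) M] [IsManifold (𝓡 4) ∞ M],
ContinuousMap.HomotopyEquiv M (Metric.sphere (0 : EuclideanSpace ℝ (Fin 5)) 1) → ∃ (P : Type) (_ :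
TopologicalSpace P) (_ : T2Space P) (_ : SecondCountableTopology P) (_ : ChartedSpace
(EuclideanSpace ℝ (Fin 4)) P) (_ : IsManifold (𝓡 4) ∞ P),
Literature.Topology.FourManifolds.IsConnectedSum (𝓡 4) (𝓡 4) (𝓡 4) M
Literature.Topology.FourManifolds.ComplexProjectivePlane P ∧ Nonempty (P ≃ₘ⟮𝓡 4, 𝓡 4⟯
Literature.Topology.FourManifolds.ComplexProjectivePlane)) ∧ (∀ (M : Type) [TopologicalSpace M]
[T2Space M] [SecondCountableTopology M] [ChartedSpace (EuclideanSpace ℝ (Fin 4)) M] [IsManifold (𝓡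
4) ∞ M], ContinuousMap.HomotopyEquiv M (Metric.sphere (0 : EuclideanSpace ℝ (Fin 5)) 1) → (∃ (P :
Type) (_ : TopologicalSpace P) (_ : T2Space P) (_ : SecondCountableTopology P) (_ : ChartedSpace
(EuclideanSpace ℝ (Fin 4)) P) (_ : IsManifold (𝓡 4) ∞ P),
Literature.Topology.FourManifolds.IsConnectedSum (𝓡 4) (𝓡 4) (𝓡 4) M
Literature.Topology.FourManifolds.ComplexProjectivePlane P ∧ Nonempty (P ≃ₘ⟮𝓡 4, 𝓡 4⟯
Literature.Topology.FourManifolds.ComplexProjectivePlane)) → ∃ S₀ S₁ :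
Literature.Topology.FourManifolds.HomotopySphere 4, Nonempty (S₀.carrier ≃ₘ⟮𝓡 4, 𝓡 4⟯ (Metric.sphere
(0 : EuclideanSpace ℝ (Fin 5)) 1)) ∧ Nonempty (S₁.carrier ≃ₘ⟮𝓡 4, 𝓡 4⟯ M) ∧ Relation.ReflTransGen
(fun S S' : Literature.Topology.FourManifolds.HomotopySphere 4 => ∃ ν : (Metric.sphere (0 :
EuclideanSpace ℝ (Fin 3)) 1) × EuclideanSpace ℝ (Fin 2) → S.carrier, Manifold.IsSmoothEmbedding ((𝓡
2).prod 𝓘(ℝ, EuclideanSpace ℝ (Fin 2))) (𝓡 4) ∞ ν ∧ Literature.Topology.FourManifolds.IsOpenGluing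
(𝓡 4) ((𝓡 2).prod 𝓘(ℝ, EuclideanSpace ℝ (Fin 2))) (𝓡 4) (A := ↥(⟨(closure (Set.range fun s :
(Metric.sphere (0 : EuclideanSpace ℝ (Fin 3)) 1) => ν (s, 0)))ᶜ, isClosed_closure.isOpen_compl⟩ :
TopologicalSpace.Opens S.carrier)) (B := (Metric.sphere (0 : EuclideanSpace ℝ (Fin 3)) 1) ×
EuclideanSpace ℝ (Fin 2)) (P := S'.carrier) (fun a b => b.2 ≠ 0 ∧ (a : S.carrier) = ν
(Literature.Topology.FourManifolds.gluckMap b))) S₀ S₁) ∧ (∀ S S' :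
Literature.Topology.FourManifolds.HomotopySphere 4, (∃ K :
Literature.Topology.FourManifolds.TwoKnot, Literature.Topology.FourManifolds.IsGluckTwist (𝓡 4)
S.carrier K) → (∃ ν : (Metric.sphere (0 : EuclideanSpace ℝ (Fin 3)) 1) × EuclideanSpace ℝ (Fin 2) →
S.carrier, Manifold.IsSmoothEmbedding ((𝓡 2).prod 𝓘(ℝ, EuclideanSpace ℝ (Fin 2))) (𝓡 4) ∞ ν ∧
Literature.Topology.FourManifolds.IsOpenGluing (𝓡 4) ((𝓡 2).prod 𝓘(ℝ, EuclideanSpace ℝ (Fin 2))) (𝓡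
4) (A := ↥(⟨(closure (Set.range fun s : (Metric.sphere (0 : EuclideanSpace ℝ (Fin 3)) 1) => ν (s,
0)))ᶜ, isClosed_closure.isOpen_compl⟩ : TopologicalSpace.Opens S.carrier)) (B := (Metric.sphere (0 :
EuclideanSpace ℝ (Fin 3)) 1) × EuclideanSpace ℝ (Fin 2)) (P := S'.carrier) (fun a b => b.2 ≠ 0 ∧ (a
: S.carrier) = ν (Literature.Topology.FourManifolds.gluckMap b))) → ∃ K :
Literature.Topology.FourManifolds.TwoKnot, Literature.Topology.FourManifolds.IsGluckTwist (𝓡 4)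
S'.carrier K) ∧ (∀ (K : Literature.Topology.FourManifolds.TwoKnot) (X : Type) [TopologicalSpace X]
[T2Space X] [SecondCountableTopology X] [ChartedSpace (EuclideanSpace ℝ (Fin 4)) X] [IsManifold (𝓡
4) ∞ X], Literature.Topology.FourManifolds.IsGluckTwist (𝓡 4) X K → Nonempty (X ≃ₘ⟮𝓡 4, 𝓡 4⟯
Metric.sphere (0 : EuclideanSpace ℝ (Fin 5)) 1))`

## Assembly
Proved packaging only: for M ≃ₕ S⁴ with an atlas, DissolveOne dissolves M; DissolvableGluckReachable
yields records S₀ ≅ S⁴, S₁ ≅ M and a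
chain of Gluck steps S₀ ↝ … ↝ S₁; S₀ is a Gluck twist of the unknot (tree theorem
isGluckTwist_sphere_unknotTwo_holds transported along
S⁴ ≅ S₀ by IsOpenGluing.diffeomorph_comp_of_boundaryless); induction on the chain with
GluckTwistOfGluckTwist makes S₁ a Gluck twist of
S⁴ along some K; transport along S₁ ≅ M and GluckTwistsStandard K M give M ≃ₘ S⁴. Deciding theorem
`closes (h₁ : DissolveOne)
(h₂ : DissolvableGluckReachable) (h₃ : GluckTwistOfGluckTwist) (h₄ : GluckTwistsStandard) :
SmoothPoincare4` in w2/glue.lean (ONE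
theorem, 18 lines, all four binders consumed; w2/GlueCheck.lean rc 0, axioms propext /
Classical.choice / Quot.sound).

Rationale: WHY THIS LINE. Kirby Problem N4.51(A) (Akbulut; Kirby1984 list p.469,
lit:book:gordon1984-four-manifold-theory) asks whether simple-homotopy-equivalent
closed smooth 4-manifolds differ by a SEQUENCE of Gluck twists on embedded 2-spheres; for the pair
(Σ, S⁴) this is «Σ has finite Gluck
length», and Kirby 1989 (lit:book:kirby1989-topology-4-manifolds p.14) names the Gluck construction
the one known «bushel basket» of
homotopy 4-spheres. The residual of record of this lineage, DissolvableIsGluck #17709 («dissolvable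
⟹ Gluck length ≤ 1»), factors
EXACTLY through the length filtration: «dissolvable ⟹ finite length» (DissolvableGluckReachable) and
«length never exceeds 1»
(GluckTwistOfGluckTwist — a Gluck twist of a Gluck twist of S⁴ is a Gluck twist of S⁴, which
contains the 2-component 2-link problem).
Both halves are printed-open structural statements and BOTH are strictly below the parent in the
kernel (the gen-4 critic's dial
illusion — one half a theorem — does not occur). Imported: 2-knot / 2-link Kirby calculus
(Gompf–Stipsicz §6.2, GluckTAMS1962 §8),
5-dimensional duals-of-cores handle pictures, the Melvin / KPRT stabilisation M_S # ℂℙ² ≅ M # ℂℙ²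
(arXiv:2206.14113 Lemma 3.1) for the
exactness. What it does that DissolvableGluck / RootDecompL do not: it types Kirby N4.51(A)|S⁴
inside the tree's IsOpenGluing/gluckMap
vocabulary (no new Literature definition) and separates the REACHABILITY content of DIG from its
COLLAPSE content.
Negatives index: empty for this summit.

RANKED CRUXES. #2 GluckTwistOfGluckTwist (crux) — GTG — a Gluck twist of a Gluck twist of S⁴ is a
Gluck twist of S⁴: if the homotopy 4-sphere S is a Gluck twist of S⁴ along a 2-knot (tree
IsGluckTwist) and S' is obtained from S by ONE GLUCK STEP (twist along ANY smoothly embedded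
2-sphere with trivialised normal bundle in S), then S' is again a Gluck twist of S⁴ along some
2-knot. Equivalently the class G of Gluck twists is closed under Gluck steps; by induction on the
chain every Gluck-reachable Σ has Gluck length ≤ 1 (GluckLength.isGluck_of_gluckReachable). Contains
the 2-component 2-LINK problem «(S⁴)_{K₁∪K₂} ≅ (S⁴)_{K'} for some 2-knot K'». ATTACKED child of the
split of DissolvableIsGluck #17709 (lens-2 g5 GluckLength); at the level of L's parent: AllGluck
#27057 ⟺ AllGluckReachable ∧ GTG EXACTLY and UNCONDITIONALLY
(GluckLength.allGluck_iff_reachable_and_closed). Tags: WEAKER (⟸ AllGluck trivially, ⟸ S,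
kernel-unconditional; ⟸ DIG mod «Gluck steps preserve dissolvability»; gives DIG only with DGR, S
only with the other six leaves) · UNDECIDED (no source decides it) · DECIDED-TRUE desk rows: S' = S
twisted along an UNKNOTTED sphere (KPRT Prop 1.5: M_T ≅ M), along the DUAL CORE (τ² ≃ id: back to
S⁴), along a sphere IN A BALL (Σ_K # Σ_J ≅ Σ_{K#J} via the splitting 3-sphere, ±1-surgery on the
unknot), along a sphere 0-CONCORDANT in S to one of these (Sunukjian arXiv:1305.6542) · ATTACKABLE
(Kirby calculus on 2-link twists without 3-handles; 5-dimensional dual-sphere picture: both twists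
bound Gluck 2-handle cobordisms over S⁴) · INSTRUMENTABLE (1-sided census test T-GTG: twist a second
sphere in the published GNS / AK diagrams and search for a single-knot presentation). [difficulty:
open-problem] (why it might fail: A 2-component 2-link K₁∪K₂ ⊂ S⁴ whose double twist (S⁴)_{K₁∪K₂} is
exotic while all single twists Σ_K are standard (or merely one not presentable by a single 2-knot)
refutes it; no invariant separates Gluck length 2 from length 1, and the second sphere can meet
every dual of the first essentially.) [arXiv:2206.14113, GluckTAMS1962, arXiv:1305.6542, Kirby1984,
GompfStipsicz1999, arXiv:2307.06388]
#3 DissolvableGluckReachable (crux) — DGR — every ℂℙ²-dissolvable smooth homotopy 4-sphere M is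
GLUCK-REACHABLE: there are homotopy-sphere records S₀ ≅ S⁴ and S₁ ≅ M and a finite chain S₀ ↝ … ↝ S₁
of GLUCK STEPS (S' is the Gluck twist of S along a smoothly embedded 2-sphere with trivialised
normal bundle ν : S²×ℝ² ↪ S — the tree's gluing relation gluckRel with ambient S⁴ replaced by S,
typed inline over IsOpenGluing/gluckMap; chains = Relation.ReflTransGen). The ℂℙ²-dissolvable
instance of Kirby Problem N4.51(A) (Akbulut; 1984 list p.469: «pass from M₁ to M₂ by a series of
Gluck twists on imbedded 2-spheres», printed OPEN; remark: yes for M₁ = S⁴, M₂ = the AK/CS sphere).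
NEW DECLARED RESIDUAL of the lens-2 lineage (gen 5 GluckLength): child of DissolvableIsGluck #17709
with DIG ⟺ DGR ∧ GluckTwistOfGluckTwist (glue GluckLength.dissolvableIsGluck_of_split UNCONDITIONAL;
converse dgr_of_dig UNCONDITIONAL, gtg_of_dig mod «Gluck steps preserve ℂℙ²-dissolvability» =
general-ambient Melvin, KPRT arXiv:2206.14113 Lemma 3.1 / GS Ex. 5.2.7(b)). Tags: WEAKER (⟸ DIG, ⟸
S, ⟸ AllGluckReachable = N4.51(A)|S⁴, all kernel-unconditional; gives DIG/S only together with GTG)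
· UNDECIDED (printed open) · DECIDED-TRUE rows: every Gluck twist (length 1), every 2-link twist
(S⁴)_L (length ≤ |L|), the Cappell–Shaneson/AK spheres (Aitchison–Rubinstein 1984 p.8: «either S⁴ or
obtained from S⁴ by the Gluck construction») · IDEA-NEEDED (no instrument decides reachability of a
given Σ; one-sided certificate = exhibit the chain) · not barrier-excluded (all catalogued SPC4
barriers are invariant-blindness results; DGR is a structural existence claim). [difficulty:
open-problem] (why it might fail: A ℂℙ²-dissolvable exotic sphere of infinite Gluck length — e.g. an
exotic D(P) (MMSW Q9.12) or cork twist with no 2-sphere presentation at all — refutes it; Kirby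
N4.51(A) is open even for M₁ = S⁴ and 'no' is the recorded expert guess for general pairs
(Weinberger: no for lens spaces × S¹).) [Kirby1984, lit:book:gordon1984-four-manifold-theory,
arXiv:2206.14113, GompfStipsicz1999, Melvin1977, arXiv:1910.08195]
#4 GluckTwistsStandard (crux) — POOLED stmt-SmoothPoincare4-17711 (route DissolvableGluck; body
byte-identical): every Gluck twist of S⁴ along a 2-knot is diffeomorphic to S⁴ — the Gluck twist
conjecture B4 (Kirby Problem 4.24, open since 1962); CUT in route RootDecompL as GluckTwistsGsc ∧
GluckTwistsMirrorDissolve ∧ GluckGscMirrorStandard (proved iff there). Tags: WEAKER (S ⟹ it, proved)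
· UNDECIDED · ATTACKED elsewhere (L's three Gluck cells; lens-3/5 presentation spheres).
[difficulty: open-problem] (why it might fail: an exotic Gluck twist — e.g. on a 2-knot both of
whose ribbon hemispheres have undisking number ≥ 2, where no 5-dimensional cancellation is known
(GNS Q5.4) — refutes it; no invariant is known to see it (ℂℙ²-stable invariants are blind by the
barrier).) [GluckTAMS1962, Kirby1984, arXiv:2307.06388, arXiv:2212.02004]
#5 DissolveOne (crux) — POOLED stmt-SmoothPoincare4-17710 (route DissolvableGluck; body
byte-identical; ATTACKED child of HomotopySpheresAreGluckTwists in RootDecompL rev 1): every smooth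
homotopy 4-sphere M dissolves after one ℂℙ²: M # ℂℙ² ≅ ℂℙ². Tags: WEAKER (S ⟹ it, proved) ·
UNDECIDED · INSTRUMENTABLE (T-DISSOLVE on diagrams) · decided TRUE on every Gluck twist (Melvin / GS
Ex. 5.2.7(b)) and on doubles of ribbon-disc exteriors. [difficulty: open-problem] (why it might
fail: a homotopy 4-sphere needing two or more ℂℙ² summands (or only the opposite chirality) to
dissolve — e.g. an exotic double D(P) of a contractible AC-nontrivial 2-handlebody (MMSW Q9.12) —
refutes it; nothing is known beyond Gluck twists and ribbon doubles.) [arXiv:1910.08195,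
arXiv:2206.14113, GompfStipsicz1999, Melvin1977]

TWO-LAYER PLAN. Proved glue (kernel, decomp-sp4-lens-2/v5/GluckLength.lean): SmoothPoincare4 ⟸
DissolveOne ∧ DissolvableIsGluck ∧ GluckTwistsStandard
(route DissolvableGluck's closes) and DissolvableIsGluck ⟸ DissolvableGluckReachable ∧
GluckTwistOfGluckTwist (dissolvableIsGluck_of_split,
UNCONDITIONAL; converse dgr_of_dig UNCONDITIONAL, gtg_of_dig modulo GluckStepDissolves). Foreseen
below the pieces (not filed):
GluckTwistOfGluckTwist ⇐ [LinkTwistIsKnotTwist: (S⁴)_(K₁∪K₂) ≅ (S⁴)_(K') for 2-component 2-links] +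
[every Gluck step out of Σ_K is a
2-link twist of S⁴ up to diffeomorphism: push the second sphere off the dual core];
DissolvableGluckReachable ⇐ [dissolvable ⟹ presented
by a 2-link / by a sequence of sphere twists in a simply connected dissolvable host] — IDEA-NEEDED,
no split foreseen this generation.
GluckTwistsStandard is cut in RootDecompL (attach, do not re-file).

KILL CRITERIA. Any piece refuted refutes SPC4 itself (all four are S-implied, proved: dgr_of_spc4,
gtg_of_spc4, and the DissolvableGluck necessity
lemmas) — route closes refuted:<Decl> and the summit is decided negatively. If DissolvableIsGluck
#17709 is PROVED directly, both new
pieces follow modulo the Melvin/KPRT fact (dig_iff_split) — close superseded by DissolvableGluck. If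
HomotopySpheresAreGluckTwists #27057
is proved, GluckTwistOfGluckTwist and AllGluckReachable follow unconditionally
(allGluck_iff_reachable_and_closed). If GluckTwistsStandard

NOT DECOMPOSED YET. The 2-link form of GluckTwistOfGluckTwist (needs «Gluck twist of S⁴ along a
2-LINK», absent from the tree: IsGluckTwist is single-knot,
ambient S⁴); IsGluckTwist relative to an ambient 4-manifold M as a NAMED Literature predicate (here
inlined over IsOpenGluing/gluckMap with a
closure-complement Opens, proved equal to the tree's knot complement for S⁴:
coreComplement_tubularNbhd); the published fact
GluckStepDissolves (M_S # ℂℙ² ≅ M # ℂℙ² for any embedded sphere S with trivial normal bundle in a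
homotopy 4-sphere M; KPRT Lemma 3.1 /
GS Ex. 5.2.7(b)) is carried as a HYPOTHESIS of the exactness lemmas only, never in closes.

CHEAPEST FALSIFIER. Desk test T-GTG (0–5 core-h, Kirby calculus by hand on published diagrams: GNS
arXiv:2307.06388 Figs. 2–9, Gompf–Stipsicz §6.2): take a
Gluck twist Σ_(K₁) drawn without 3-handles, choose a second 2-knot K₂ in the complement meeting the
dual core essentially, twist both;
search for a single-2-knot presentation of (S⁴)_(K₁∪K₂). FOUND for every tried specimen ⇒ P3
evidence for GluckTwistOfGluckTwist;
a specimen resisting all searches ⇒ the first named candidate of Gluck length 2 (kills nothing, but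
prices the piece). In-Lean (done):
bc/Probe.lean 22/22 probes FAIL (piece → S, piece → DIG, piece → AllGluck, pieces outright and
negated, IsGluck/GluckStep/HasFiniteGluckLength
on a variable provable-or-refutable; bc/probe_output.txt); #h21_crux_probe 4/4 CLEAN
(bc/cruxprobe_output.txt).

NUMBERS. Kirby N4.51(A) (1984 list p.469): open; «yes» recorded for M₁ = S⁴, M₂ = the AK double
cover of a Cappell–Shaneson fake RP⁴ (length ≤ 1,
later = 0 by Gompf 1991 / Akbulut 2010); «no» for lens spaces × S¹ (Weinberger) — irrelevant to
homotopy spheres. Aitchison–Rubinstein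
1984 (p.8): all Cappell–Shaneson spheres of their infinite family are S⁴ or a single Gluck twist of
S⁴. Every 2-link twist (S⁴)_L has
Gluck length ≤ |L| by definition; no homotopy 4-sphere of Gluck length provably ≥ 2 — indeed none
provably ≥ 1 — is known. B4 known for
ribbon, twist-spun, 0-concordant-to-unknot 2-knots and ribbon ∪ twist-roll-spun discs (Gordon 1976,
Melvin 1977, Sunukjian 2015,
Naylor–Schwartz 2022, GNS 2025 Cor 5.3). ledger negatives SmoothPoincare4 = 0.

DEFINITION REQUESTS. None for the items (all over HomotopySphere 4, TwoKnot, IsGluckTwist,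
IsOpenGluing, gluckMap, Manifold.IsSmoothEmbedding, IsConnectedSum,
ComplexProjectivePlane, Diffeomorph, Relation.ReflTransGen — `lean search --decl` confirmed each;
split/SigCheck.lean rc 0). Wanted later
for layer-2 stubs: IsGluckTwist along a 2-LINK and relative to an ambient 4-manifold (Kirby 4.51(A)
form) as named Literature predicates.

Novelty: Searches (2026-08-30, both corpora): lit search --hybrid "Gluck twist on a link of 2-spheres both
components homotopy 4-sphere" -n 8 → generic hits only [corpus:book:gordon1984-four-manifold-theory
p.8, p.469, p.470], [corpus:book:kirby1989-topology-4-manifolds p.14] (READ: N4.51(A)/(B) text,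
Aitchison–Rubinstein intro, Kirby's «bushel baskets»); lit vsearch "a Gluck twist of a Gluck twist
of the four-sphere is again a Gluck twist of the four-sphere" -k 8 → no source deciding it
([corpus:paper:arxiv-2206.14113 p.4 Prop 1.5 unknotted case, p.8 Lemma 3.1] nearest); lit galaxy
search "sequence of Gluck twists|iterated Gluck|two Gluck twists" --star all -n 10 → 0 relevant (1
false positive, panama:7937099563100 = the composer); lit galaxy search "Gluck twist on a link|Gluck
twists on links|twisting both components" --star all → 0; lit galaxy search "Gluck twist" --star pdf
→ 0 (galaxy substring index does not cover the 2-knot literature); rg over the 82 Theses of the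
summit: no item uses a Gluck chain / Relation.ReflTransGen / Kirby 4.51 except this lineage's own
RootDecompL docstrings.
Nearest prior art found: route DissolvableGluck (DIG #17709 unsplit; this draft = DissolvableGluck
with DIG split one level, exactly as RootDecompN = RootDecompB with R split); route RootDecompL rev
2 (this lineage; AllGluck ⟸ DissolveOne ∧ DIG); Kirby Problem N4.51(A)
[corpus:book:gordon1984-four-manifold-theory p.469 L19–21]; KPRT arXiv:2206.14113 (Gluck twists of
homotopic spheres are simple ho  [refs: 2206.14113, book:gordon1984-four-manifold-theory, book:kirby1989-topology-4-manifolds, paper:arxiv-2206.14113]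

Barriers (technique_class: gluck-twist, kirby-calculus, handle-calculus-5d): - technique_class: gluck-twist, kirby-calculus, handle-calculus-5d
- Literature.Barriers.SmoothPoincare4.GluckTwistCP2Barrier: consistent and outside its technique
class — the barrier kills DETECTION of a Gluck twist by a ℂℙ²-cancellative (stable) invariant; both
new pieces are structural existence claims (a chain exists / a single-knot presentation exists), not
invariant computations; the barrier's fact (a) «Gluck twists dissolve» is exactly why
DissolvableGluckReachable is the dissolvable SHADOW of N4.51(A)|S⁴ and why DIG ⟹ GTG holds modulo
the general-ambient form of (a).
- Literature.Barriers.SmoothPoincare4.HCobordismBarrierFour: not invoked — no piece infers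
diffeomorphism from h-cobordism; chains of Gluck steps are diffeomorphism-level surgeries.
- Literature.Barriers.SmoothPoincare4.GaugeSumBarrierFour: (with the stable and
topological-invariants-blind barriers of the same family) consistent — they explain why neither new
piece can be REFUTED by a known invariant (all Gluck-reachable spheres are homeomorphic to S⁴ and
ℂℙ²-stably standard), i.e. why the pieces are UNDECIDED rather than false; no piece asks an
invariant to see Σ.
- Literature.Barriers.SmoothPoincare4.ContractibleBarrierFour: (cork non-uniqueness) consistent — no
uniqueness of contractible pieces is asserted; a cork twist that is NOT Gluck-reachable would refute
DissolvableGluckReachable (named in its why-might-fail), which is the honest bet of the residual.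
- TwistedSphereBarrierFour: not a dichotomy si

History (route lifecycle, newest last):
- 2026-08-31T02:27:46Z · RESIDUAL declared: DissolvableGluckReachable (stmt-SmoothPoincare4-28588) — summit-strength until shown otherwise: g18 schema migration (D-0170): tribunal residual of record (stmt-SmoothPoincare4-28588, route tribunal.residual; TREE-IN (planner-decomp-sp4-writer-1-g18-0)

sub-problem: SmoothPoincare4 · status: open · opened planner-decomp-sp4-writer-1-g2-0 2026-08-30T05:36:58Z · rev 1 · ledger route-SmoothPoincare4-RootDecompP
GENERATED by the gate from the ledger (D-0016/17). Provers cite these decls: `theorem foo : Summit.SmoothPoincare4.SmoothPoincare4.Theses.RootDecompP.<Decl> := …` in Summits/SmoothPoincare4/SmoothPoincare4/Theorems/<Name>.lean.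
-/

namespace Summit.SmoothPoincare4.SmoothPoincare4.Theses.RootDecompP

open scoped BigOperators Topology Manifold Classical MeasureTheory ProbabilityTheory Matrix InnerProductSpace ComplexConjugate ContinuousMap
open Filter Set Function TopologicalSpace MeasureTheory

attribute [summit_statement] _root_.SmoothPoincare4

open Literature.SPC4

/-- item stmt-SmoothPoincare4-28587 · crux · rank 2 · open · by planner
why it might fail: A 2-component 2-link K₁∪K₂ ⊂ S⁴ whose double twist (S⁴)_{K₁∪K₂} is exotic while all single twists Σ_K are standard (or merely one not presentable by a single 2-knot) refutes it; no invariant separates Gluck length 2 from length 1, and the second sphere can meet every dual of the first essentially.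
sources: arXiv:2206.14113, GluckTAMS1962, arXiv:1305.6542, Kirby1984, GompfStipsicz1999, arXiv:2307.06388
[crux] GTG — a Gluck twist of a Gluck twist of S⁴ is a Gluck twist of S⁴: if the homotopy 4-sphere S
is a Gluck twist of S⁴ along a 2-knot (tree IsGluckTwist) and S' is obtained from S by ONE GLUCK
STEP (twist along ANY smoothly embedded 2-sphere with trivialised normal bundle in S), then S' is
again a Gluck twist of S⁴ along some 2-knot. Equivalently the class G of Gluck twists is closed
under Gluck steps; by induction on the chain every Gluck-reachable Σ has Gluck length ≤ 1
(GluckLength.isGluck_of_gluckReachable). Contains the 2-component 2-LINK problem «(S⁴)_{K₁∪K₂} ≅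
(S⁴)_{K'} for some 2-knot K'». ATTACKED child of the split of DissolvableIsGluck #17709 (lens-2 g5
GluckLength); at the level of L's parent: AllGluck #27057 ⟺ AllGluckReachable ∧ GTG EXACTLY and
UNCONDITIONALLY (GluckLength.allGluck_iff_reachable_and_closed). Tags: WEAKER (⟸ AllGluck trivially,
⟸ S, kernel-unconditional; ⟸ DIG mod «Gluck steps preserve dissolvability»; gives DIG only with DGR,
S only with the other six leaves) · UNDECIDED (no source decides it) · DECIDED-TRUE desk rows: S' =
S twisted along an UNKNOTTED sphere (KPRT Prop 1.5: M_T ≅ M), along the DUAL CORE (τ² ≃ id: back to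
S⁴), along a sphere IN A -/
@[route_item "route-SmoothPoincare4-RootDecompP", crux]
def GluckTwistOfGluckTwist : Prop :=
  open scoped ContDiff in ∀ S S' : Literature.Topology.FourManifolds.HomotopySphere 4, (∃ K : Literature.Topology.FourManifolds.TwoKnot, Literature.Topology.FourManifolds.IsGluckTwist (𝓡 4) S.carrier K) → (∃ ν : (Metric.sphere (0 : EuclideanSpace ℝ (Fin 3)) 1) × EuclideanSpace ℝ (Fin 2) → S.carrier, Manifold.IsSmoothEmbedding ((𝓡 2).prod 𝓘(ℝ, EuclideanSpace ℝ (Fin 2))) (𝓡 4) ∞ ν ∧ Literature.Topology.FourManifolds.IsOpenGluing (𝓡 4) ((𝓡 2).prod 𝓘(ℝ, EuclideanSpace ℝ (Fin 2))) (𝓡 4) (A := ↥(⟨(closure (Set.range fun s : (Metric.sphere (0 : EuclideanSpace ℝ (Fin 3)) 1) => ν (s, 0)))ᶜ, isClosed_closure.isOpen_compl⟩ : TopologicalSpace.Opens S.carrier)) (B := (Metric.sphere (0 : EuclideanSpace ℝ (Fin 3)) 1) × EuclideanSpace ℝ (Fin 2)) (P := S'.carrier) (fun a b => b.2 ≠ 0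 ∧ (a : S.carrier) = ν (Literature.Topology.FourManifolds.gluckMap b))) → ∃ K : Literature.Topology.FourManifolds.TwoKnot, Literature.Topology.FourManifolds.IsGluckTwist (𝓡 4) S'.carrier K

/-- item stmt-SmoothPoincare4-28588 · crux · RESIDUAL (gen 0; summit-strength until shown otherwise, D-0170) · rank 3 · open · by planner
why it might fail: A ℂℙ²-dissolvable exotic sphere of infinite Gluck length — e.g. an exotic D(P) (MMSW Q9.12) or cork twist with no 2-sphere presentation at all — refutes it; Kirby N4.51(A) is open even for M₁ = S⁴ and 'no' is the recorded expert guess for general pairs (Weinberger: no for lens spaces × S¹).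
sources: Kirby1984, lit:book:gordon1984-four-manifold-theory, arXiv:2206.14113, GompfStipsicz1999, Melvin1977, arXiv:1910.08195
[crux] DGR — every ℂℙ²-dissolvable smooth homotopy 4-sphere M is GLUCK-REACHABLE: there are
homotopy-sphere records S₀ ≅ S⁴ and S₁ ≅ M and a finite chain S₀ ↝ … ↝ S₁ of GLUCK STEPS (S' is the
Gluck twist of S along a smoothly embedded 2-sphere with trivialised normal bundle ν : S²×ℝ² ↪ S —
the tree's gluing relation gluckRel with ambient S⁴ replaced by S, typed inline over
IsOpenGluing/gluckMap; chains = Relation.ReflTransGen). The ℂℙ²-dissolvable instance of Kirby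
Problem N4.51(A) (Akbulut; 1984 list p.469: «pass from M₁ to M₂ by a series of Gluck twists on
imbedded 2-spheres», printed OPEN; remark: yes for M₁ = S⁴, M₂ = the AK/CS sphere). NEW DECLARED
RESIDUAL of the lens-2 lineage (gen 5 GluckLength): child of DissolvableIsGluck #17709 with DIG ⟺
DGR ∧ GluckTwistOfGluckTwist (glue GluckLength.dissolvableIsGluck_of_split UNCONDITIONAL; converse
dgr_of_dig UNCONDITIONAL, gtg_of_dig mod «Gluck steps preserve ℂℙ²-dissolvability» = general-ambient
Melvin, KPRT arXiv:2206.14113 Lemma 3.1 / GS Ex. 5.2.7(b)). Tags: WEAKER (⟸ DIG, ⟸ S, ⟸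
AllGluckReachable = N4.51(A)|S⁴, all kernel-unconditional; gives DIG/S only together with GTG) ·
UNDECIDED (printed open) · DECIDED-TRUE rows: every Glu -/
@[route_item "route-SmoothPoincare4-RootDecompP", crux (bottleneck := idea) (source := "ledger wanted_by.residual on stmt-SmoothPoincare4-28588, 2026-09-01")]
def DissolvableGluckReachable : Prop :=
  open scoped ContDiff in ∀ (M : Type) [TopologicalSpace M] [T2Space M] [SecondCountableTopology M] [ChartedSpace (EuclideanSpace ℝ (Fin 4)) M] [IsManifold (𝓡 4) ∞ M], ContinuousMap.HomotopyEquiv M (Metric.sphere (0 : EuclideanSpace ℝ (Fin 5)) 1) → (∃ (P : Type) (_ : TopologicalSpace P) (_ : T2Space P) (_ : SecondCountableTopology P) (_ : ChartedSpace (EuclideanSpace ℝ (Fin 4)) P) (_ : IsManifold (𝓡 4) ∞ P), Literature.Topology.FourManifolds.IsConnectedSum (𝓡 4) (𝓡 4) (𝓡 4) M Literature.Topology.FourManifolds.ComplexProjectivePlane P ∧ Nonempty (P ≃ₘ⟮𝓡 4, 𝓡 4⟯ Literature.Topology.FourManifolds.ComplexProjectivePlane)) → ∃ S₀ S₁ :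 Literature.Topology.FourManifolds.HomotopySphere 4, Nonempty (S₀.carrier ≃ₘ⟮𝓡 4, 𝓡 4⟯ (Metric.sphere (0 : EuclideanSpace ℝ (Fin 5)) 1)) ∧ Nonempty (S₁.carrier ≃ₘ⟮𝓡 4, 𝓡 4⟯ M) ∧ Relation.ReflTransGen (fun S S' : Literature.Topology.FourManifolds.HomotopySphere 4 => ∃ ν : (Metric.sphere (0 : EuclideanSpace ℝ (Fin 3)) 1) × EuclideanSpace ℝ (Fin 2) → S.carrier, Manifold.IsSmoothEmbedding ((𝓡 2).prod 𝓘(ℝ, EuclideanSpace ℝ (Fin 2))) (𝓡 4) ∞ ν ∧ Literature.Topology.FourManifolds.IsOpenGluing (𝓡 4) ((𝓡 2).prod 𝓘(ℝ, EuclideanSpace ℝ (Fin 2))) (𝓡 4) (A := ↥(⟨(closure (Set.range fun s : (Metric.sphere (0 : EuclideanSpace ℝ (Fin 3)) 1) => ν (s, 0)))ᶜ, isClosed_closure.isOpen_compl⟩ : TopologicalSpace.Opens S.carrier)) (B := (Metric.sphere (0 : EuclideanSpace ℝ (Fin 3)) 1) × EuclideanSpace ℝ (Fin 2)) (P := S'.carrier)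 (fun a b => b.2 ≠ 0 ∧ (a : S.carrier) = ν (Literature.Topology.FourManifolds.gluckMap b))) S₀ S₁

/-- item stmt-SmoothPoincare4-17711 · crux · rank 4 · SPLIT (gen 1) into GluckWidthLEFour, GluckWidthSix, GluckWidthGEEight + glue GluckTwistsStandardGlue · direct attempts still welcome (low priority) · by planner
why it might fail: an exotic Gluck twist — e.g. on a 2-knot both of whose ribbon hemispheres have undisking number ≥ 2, where no 5-dimensional cancellation is known (GNS Q5.4) — refutes it; no invariant is known to see it (ℂℙ²-stable invariants are blind by the barrier).
sources: GluckTAMS1962, Kirby1984, arXiv:2307.06388, arXiv:2212.02004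
[crux] GLUCK — the Gluck twist conjecture: for every smooth 2-knot K and every smooth 4-manifold X
that is a Gluck twist of S⁴ along K, X ≅ S⁴. Verbatim the body of the registered open
`Literature.Topology.FourManifolds.GluckTwistConjecture.{0}` (Iff.rfl, gluckTwistsStandard_iff),
inlined as this route's own crux per the conjecture rule; = X₁ restricted to Gluck twists
(gluck_of_cancel, proved). Birth line bc/GluckTwistsStandard_birth.lean: §17 (tree theorem) +
stub_gluckInvertible (GNS 2025 Q5.6: Gluck twists are invertible / Schoenflies balls) +
stub_invertibleStandard (= OneStabInvertible.InvertibleStandard, stmt-SmoothPoincare4-18065).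
[difficulty: open-problem] -/
@[route_item "route-SmoothPoincare4-RootDecompP", crux]
def GluckTwistsStandard : Prop :=
  open scoped ContDiff in ∀ (K : Literature.Topology.FourManifolds.TwoKnot) (X : Type) [TopologicalSpace X] [T2Space X] [SecondCountableTopology X] [ChartedSpace (EuclideanSpace ℝ (Fin 4)) X] [IsManifold (𝓡 4) ∞ X], Literature.Topology.FourManifolds.IsGluckTwist (𝓡 4) X K → Nonempty (X ≃ₘ⟮𝓡 4, 𝓡 4⟯ Metric.sphere (0 : EuclideanSpace ℝ (Fin 5)) 1)

-- parent: GluckTwistsStandard · child (gen 1)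
/--     item stmt-SmoothPoincare4-30626 · crux · rank 402 · open
    parent: GluckTwistsStandard · by planner
    why it might fail: An exotic Gluck twist on a width-6 knot — two symmetry-related 1-band ribbon discs of one knot (GNS Rem 5.2: 8_8, 9_27, 9_41, 10_48, … beyond the CS/8_9 case) or a one-maximum knot (MZ Q4.7) — refutes it and SPC4 at once (shielded); no uniform width-6 argument exists in print.
    sources: GabaiNaylorSchwartz2025 arXiv:2307.06388 Lemma 2.5, Lemma 2.7, Def 2.9, Thm 1.1/1.3, Rem 5.2, Q5.4, Thm 5.5, Q5.6 [corpus:paper:arxiv-2307.06388 p0003 L7-L27, p0004 L15-L44, p0005 L8-L41, p0013 L12-L31], MeierZupan2017 arXiv:1507.08370 Prop 1.11, Cor 1.12, Prop 4.6, Question 4.7 [corpus:paper:arxiv-1507.08370 p0004 L46-L52, p0015 L35-L44], Gordon1976 (Comment. Math. Helv. 51; twist-spun knots) and Gluck1962 (ribbon knots) as listed in GNS §2.1 [corpus:paper:arxiv-2307.06388 p0004 L15-L21], Gompf2010 arXiv:0908.1914 / AkbulutKirby1985 (Cappell–Shaneson spheres standard; Literature/Barriers/SmoothPoincare4/CappellShanesonAkbulutKirby.lean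 A8), Kirby1997 Problem 4.24 (Gluck twist question) [corpus:book:gordon1984-four-manifold-theory p0465], stmt-SmoothPoincare4-0435
GLUCK-WIDTH SIX (4 < c ≤ 6) — THE ATTACKED RUNG: B4 restricted to Gluck twists X presented by a
2-knot K in Morse position with exactly SIX critical points (c odd is impossible). By the
Kawauchi–Shibuya–Suzuki normal form (GNS 2025 Lemma 2.5: after band slides the k bands are n−1
fusion bands followed by m−1 fission bands, n + k + m = c, k − n + 1 = m − 1) a width-6 knot is of
type (n,k,m) ∈ {(2,2,2), (3,2,1), (1,2,3)}: (2,2,2) = D₁ ∪_k D̄₂, the union of two ONE-band ribbon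
discs of one fusion-number-1 ribbon knot k; (3,2,1) and its reverse = ONE-MAXIMUM knots D ∪_O D₀ (D
a 2-band ribbon disc of the unknot O): knot group ℤ (Meier–Zupan Prop 1.11), TOPOLOGICALLY unknotted
(MZ Cor 1.12), smooth status = MZ Question 4.7. HANDLES (GNS Lemma 2.7 + Def 2.9, cancelling the
first 1-handle μ₁ against the ±1-framed Gluck 2-handle h_*): Σ of a (2,2,2)-knot has a (1;2;1)
handle decomposition — the population of G.GtriMorse1121 (stmt-SmoothPoincare4-0435) — and Σ of a
(3,2,1)-knot a (2;2;0) one, dually (0;2;2) — the population of G.TwoRLinkStandard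
(stmt-SmoothPoincare4-26031) ⊂ NoOneHandles (#0377); so on paper GluckWidthSix ⟸ #0435 ∧ #26031
(lattice edge to route G; dictionary = rising water, -/
@[route_item "route-SmoothPoincare4-RootDecompP"]
def GluckWidthSix : Prop :=
  open scoped ContDiff in ∀ (K : Literature.Topology.FourManifolds.TwoKnot) (X : Type) [TopologicalSpace X] [T2Space X] [SecondCountableTopology X] [ChartedSpace (EuclideanSpace ℝ (Fin 4)) X] [IsManifold (𝓡 4) ∞ X], Literature.Topology.FourManifolds.IsGluckTwist (𝓡 4) X K → Literature.Topology.FourManifolds.IsMorse (𝓡 2) (fun x : Metric.sphere (0 : EuclideanSpace ℝ (Fin 3)) 1 => (K x : EuclideanSpace ℝ (Fin 5)) (Fin.last 4)) → (∀ x : Metric.sphere (0 : EuclideanSpace ℝ (Fin 3)) 1, (K x : EuclideanSpace ℝ (Fin 5)) (Fin.last 4) ∈ Set.Ioo (-1 : ℝ) 1) → (4 < (Literature.Topology.FourManifolds.criticalSet (𝓡 2) (fun x : Metric.sphere (0 : EuclideanSpace ℝ (Fin 3)) 1 => (K x : EuclideanSpace ℝ (Fin 5)) (Fin.last 4))).ncard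 ∧ (Literature.Topology.FourManifolds.criticalSet (𝓡 2) (fun x : Metric.sphere (0 : EuclideanSpace ℝ (Fin 3)) 1 => (K x : EuclideanSpace ℝ (Fin 5)) (Fin.last 4))).ncard ≤ 6) → Nonempty (X ≃ₘ⟮𝓡 4, 𝓡 4⟯ Metric.sphere (0 : EuclideanSpace ℝ (Fin 5)) 1)

-- parent: GluckTwistsStandard · child (gen 1)
/--     item stmt-SmoothPoincare4-30627 · crux · rank 403 · open
    parent: GluckTwistsStandard · by planner
    why it might fail: It is B4 for every Gluck twist of Gluck width ≥ 8 — all 2-knots whose group needs ≥ 2 relators live here (MZ Prop 1.11 counts), incl. most Cappell–Shaneson and satellite 2-knots; an exotic one refutes it and SPC4; no engine beyond handle-by-hand (Gompf 2010) exists.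
    sources: GabaiNaylorSchwartz2025 arXiv:2307.06388 §2.1–2.3 [corpus:paper:arxiv-2307.06388 p0004-p0005], MeierZupan2017 arXiv:1507.08370 Prop 1.11 [corpus:paper:arxiv-1507.08370 p0004 L46-L47], Gompf2010 arXiv:0908.1914 (Cappell–Shaneson family by hand), Kirby1997 Problem 4.24 [corpus:book:gordon1984-four-manifold-theory p0465], Literature/Barriers/SmoothPoincare4/GluckTwistsDissolve.lean (A7 GluckTwistCP2Barrier), stmt-SmoothPoincare4-17711
GLUCK-WIDTH TAIL (Gluck width ≥ 8) — DECLARED RESIDUAL, MIN-GRADED: B4 restricted to Gluck twists X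
(along some K) such that NO 2-knot K' presenting X (IsGluckTwist (𝓡 4) X K') in Morse position has ≤
6 critical points — i.e. the GLUCK WIDTH of X, min over all presentations, is ≥ 8 (or X has no
Morse-position presentation at all, a vacuous sub-case on paper since every 2-knot is isotopic into
Morse position off the poles and IsGluckTwist is isotopy-invariant, tree
nonempty_diffeomorph_of_isGluckTwist). A DISJOINT CELL of the partition {Gluck width ≤ 4} ⊔ {= 6} ⊔
{≥ 8}, not a nested dial: GluckWidthGEEight ⟹ B4 would require the attacked rung GluckWidthSix
(kernel: parent ⟺ LEFour ∧ Six ∧ GEEight, Split.parent_iff_widths; BC2 probes GEEight → parent / →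
Six FAIL). It WEAKENS monotonically as the rung climbs (Split.tail_mono: Tail 6 → Tail 8 → …; round
k files Cell(≤ 2k+4) ∧ Tail(2k+4), Split.parent_iff_round). Population: Gluck twists all of whose
presentations need ≥ 3 minima+maxima pairs beyond the floor — e.g. twists on 2-knots of non-cyclic
group with ≥ 2 relators forced (c ≥ 8 by MZ Prop 1.11-type counts), Cappell–Shaneson knots outside
the 8₉ picture, satellites. [critic decom -/
@[route_item "route-SmoothPoincare4-RootDecompP"]
def GluckWidthGEEight : Prop :=
  open scoped ContDiff in ∀ (K : Literature.Topology.FourManifolds.TwoKnot) (X : Type) [TopologicalSpace X] [T2Space X] [SecondCountableTopology X] [ChartedSpace (EuclideanSpace ℝ (Fin 4)) X] [IsManifold (𝓡 4) ∞ X], Literature.Topology.FourManifolds.IsGluckTwist (𝓡 4) X K → (∀ K' : Literature.Topology.FourManifolds.TwoKnot, Literature.Topology.FourManifolds.IsGluckTwist (𝓡 4) X K' → Literature.Topology.FourManifolds.IsMorse (𝓡 2) (fun x : Metric.sphere (0 : EuclideanSpace ℝ (Fin 3)) 1 => (K' x : EuclideanSpace ℝ (Fin 5)) (Fin.last 4))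 → (∀ x : Metric.sphere (0 : EuclideanSpace ℝ (Fin 3)) 1, (K' x : EuclideanSpace ℝ (Fin 5)) (Fin.last 4) ∈ Set.Ioo (-1 : ℝ) 1) → 6 < (Literature.Topology.FourManifolds.criticalSet (𝓡 2) (fun x : Metric.sphere (0 : EuclideanSpace ℝ (Fin 3)) 1 => (K' x : EuclideanSpace ℝ (Fin 5)) (Fin.last 4))).ncard) → Nonempty (X ≃ₘ⟮𝓡 4, 𝓡 4⟯ Metric.sphere (0 : EuclideanSpace ℝ (Fin 5)) 1)

-- parent: GluckTwistsStandard · child (gen 1)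
/--     item stmt-SmoothPoincare4-30625 · support · rank 401 · open
    parent: GluckTwistsStandard · by planner
    why it might fail: Only as typed: Set.ncard is junk 0 on an infinite critical set (excluded — IsMorse on compact S² gives finitely many critical points) and the Ioo clause keeps K off the poles; the mathematics is Scharlemann 1985 + Gluck 1962 §17 (unknotted case), both theorems in print.
    sources: Scharlemann1985 doi:10.1007/bf01388659 (Invent. Math. 79, 125–141) [graph:doi:10.1007/bf01388659; zbMATH review quoted; acq-14872 (paywalled, WANTED filed)], Gluck1962 §17 / GompfStipsicz1999 Ex. 6.2.2(a) = tree named fact Literature.Topology.FourManifolds.nonempty_diffeomorph_sphere_four_of_isGluckTwist_of_isUnknot (SurgeryGluck.lean), KawauchiShibuyaSuzuki1982 normal form = GabaiNaylorSchwartz2025 arXiv:2307.06388 Lemma 2.5 [corpus:paper:arxiv-2307.06388 p0005], MeierZupan2017 arXiv:1507.08370 Thm 1.8 [corpus:paper:arxiv-1507.08370 p0004 L24-L25], stmt-SmoothPoincare4-17711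
GLUCK-WIDTH FLOOR (c ≤ 4) — B4 = GluckTwistsStandard (stmt-SmoothPoincare4-17711) restricted to
pairs (X, K): X a Gluck twist of S⁴ along a 2-knot K that is in MORSE POSITION (the height x₄∘K : S²
→ ℝ is Morse and K misses the poles x₄ = ±1) with at most FOUR critical points, c(K) := (criticalSet
(𝓡 2) (x₄∘K)).ncard ≤ 4. COSTUME = THEOREM IN PRINT: c = 2 is the equatorially unknotted sphere and
c = 4 (two minima/one saddle/one maximum or its reverse, by χ(S²) = 2) is unknotted by Scharlemann
1985 (Invent. Math. 79: smooth spheres in ℝ⁴ with four critical points are standard; Main Theorem: a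
band sum of two knots is unknotted only in the trivial way), whence X ≅ S⁴ by the tree's named fact
nonempty_diffeomorph_sphere_four_of_isGluckTwist_of_isUnknot (Gluck 1962 §17; Gompf–Stipsicz Ex.
6.2.2(a); its recorded proof term uses isGluckTwist_sphere_unknotTwo, as P's closes does). Kernel:
GluckWidthLEFour ⟸ WidthLEFourUnknotted (Scharlemann typed over the tree) ∧ that named fact
(Split.leFour_of_facts). = the bottom rung of the GLUCK WIDTH LADDER c ∈ {2,4} < {6} < {8,10,…};
Meier–Zupan Thm 1.8 (bridge number ≤ 3 ⇒ unknotted) is the bridge-trisection form of the same floor.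
[critic decomp-s -/
@[route_item "route-SmoothPoincare4-RootDecompP"]
def GluckWidthLEFour : Prop :=
  open scoped ContDiff in ∀ (K : Literature.Topology.FourManifolds.TwoKnot) (X : Type) [TopologicalSpace X] [T2Space X] [SecondCountableTopology X] [ChartedSpace (EuclideanSpace ℝ (Fin 4)) X] [IsManifold (𝓡 4) ∞ X], Literature.Topology.FourManifolds.IsGluckTwist (𝓡 4) X K → Literature.Topology.FourManifolds.IsMorse (𝓡 2) (fun x : Metric.sphere (0 : EuclideanSpace ℝ (Fin 3)) 1 => (K x : EuclideanSpace ℝ (Fin 5)) (Fin.last 4)) → (∀ x : Metric.sphere (0 : EuclideanSpace ℝ (Fin 3)) 1, (K x : EuclideanSpace ℝ (Fin 5)) (Fin.last 4) ∈ Set.Ioo (-1 : ℝ) 1) → (Literature.Topology.FourManifolds.criticalSet (𝓡 2) (fun x : Metric.sphere (0 : EuclideanSpace ℝ (Fin 3)) 1 => (K x : EuclideanSpace ℝ (Fin 5)) (Fin.last 4))).ncard ≤ 4 → Nonempty (X ≃ₘ⟮𝓡 4, 𝓡 4⟯ Metric.sphere (0 : EuclideanSpace ℝ (Fin 5)) 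1)

-- parent: GluckTwistsStandard · glue (gen 1)
/--     item stmt-SmoothPoincare4-30628 · support · rank 404 · closed · proved by Summit.SmoothPoincare4.SmoothPoincare4.Theorems.RootDecompPGluckTwistsStandardSplit.gluckTwistsStandardGlue_holds (prover)
    parent: GluckTwistsStandard · GLUE: children ⟹ parent · by planner
GluckWidthLEFour → GluckWidthSix → GluckWidthGEEight → GluckTwistsStandard -/
@[route_item "route-SmoothPoincare4-RootDecompP"]
def GluckTwistsStandardGlue : Prop :=
  GluckWidthLEFour → GluckWidthSix → GluckWidthGEEight → GluckTwistsStandard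

-- `GluckTwistsStandardGlue` holds: proved by `Summit.SmoothPoincare4.SmoothPoincare4.Theorems.RootDecompPGluckTwistsStandardSplit.gluckTwistsStandardGlue_holds` (its module imports this route file, so no `_holds` link can be stated here).

/-- item stmt-SmoothPoincare4-17710 · crux · rank 5 · open · by planner
why it might fail: a homotopy 4-sphere needing two or more ℂℙ² summands (or only the opposite chirality) to dissolve — e.g. an exotic double D(P) of a contractible AC-nontrivial 2-handlebody (MMSW Q9.12) — refutes it; nothing is known beyond Gluck twists and ribbon doubles.
sources: arXiv:1910.08195, arXiv:2206.14113, GompfStipsicz1999, Melvin1977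
[crux] DISSOLVE₁ — every smooth homotopy 4-sphere M has a connected sum P of M with ℂℙ²
(orientation-free IsConnectedSum) diffeomorphic to ℂℙ². The r = 1, all-Σ form of ℂℙ²-dissolution
(MMSW 2023 Question 9.12 asks ∃ r and only for balanced-presentation spheres D(P)); a consequence of
SPC4 (proved: dissolveOne_of_spc4). Birth line bc/DissolveOne_birth.lean transfers
TwistorDissolution to level one: stub_selfDualLevelOne (a PSC half-conformally-flat metric on some M
# ℂℙ²) → stub_poonLevelOne (Poon 1986: positive-type self-dual with τ = 1 is ℂℙ²). [difficulty:
open-problem] -/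
@[route_item "route-SmoothPoincare4-RootDecompP", crux]
def DissolveOne : Prop :=
  open scoped ContDiff in ∀ (M : Type) [TopologicalSpace M] [T2Space M] [SecondCountableTopology M] [ChartedSpace (EuclideanSpace ℝ (Fin 4)) M] [IsManifold (𝓡 4) ∞ M], ContinuousMap.HomotopyEquiv M (Metric.sphere (0 : EuclideanSpace ℝ (Fin 5)) 1) → ∃ (P : Type) (_ : TopologicalSpace P) (_ : T2Space P) (_ : SecondCountableTopology P) (_ : ChartedSpace (EuclideanSpace ℝ (Fin 4)) P) (_ : IsManifold (𝓡 4) ∞ P), Literature.Topology.FourManifolds.IsConnectedSum (𝓡 4) (𝓡 4) (𝓡 4) M Literature.Topology.FourManifolds.ComplexProjectivePlane P ∧ Nonempty (P ≃ₘ⟮𝓡 4, 𝓡 4⟯ Literature.Topology.FourManifolds.ComplexProjectivePlane)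

/-- item stmt-SmoothPoincare4-28589 · assembly · rank 1 · open · by planner
sources: Kirby1984, arXiv:2206.14113
[assembly] DissolveOne → DissolvableGluckReachable → GluckTwistOfGluckTwist → GluckTwistsStandard →
SmoothPoincare4 (exactly the type of the proved deciding theorem closes; kept for the schema, exempt
from staffing). [critic decomp-sp4-crit-1 g2, CLEARED 2026-08-30T05:30:10Z (HOME/STATUS.md line 225;
W1 split on route-SmoothPoincare4-DissolvableGluck REFUSED by the gate 05:3xZ «only the route's
planner … or the operator» ⇒ W2 OR-sibling, «acceptable per the N precedent»): cone 4/4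
load-bearing; deciding theorem = glue.lean `closes` (lens w2/glue.lean verbatim; native verdict OK,
axioms std)] Record: lens-2 g5 node GluckLength (NODE 05:18:17Z line 209, RESULT line 210); kernel
decomp-sp4-lens-2/v5/GluckLength.lean sha256
6d37ecc3b6e8326c12fd9cd0881d44b991a2fc729b8e1a636a8c0d91670070fb (rc 0 · 0 sorry · axioms std; glue
dissolvableIsGluck_of_split UNCONDITIONAL; exactness dig_iff_split mod GluckStepDissolves;
allGluck_iff_reachable_and_closed UNCONDITIONAL; necessity dgr_of_spc4 / gtg_of_spc4; closes =
w2/glue.lean); w2/route.json sha256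
b6f7dd3a9bf976d86604a599c518895bf00b966b67e05a00bc0af87b4539dfca, w2/glue.lean sha256
a5aaa7da8eb4c571c36d91855e17759fe9dd5b7251e37818331940fb9632b5 -/
@[route_item "route-SmoothPoincare4-RootDecompP"]
def Assembly : Prop :=
  DissolveOne → DissolvableGluckReachable → GluckTwistOfGluckTwist → GluckTwistsStandard → _root_.SmoothPoincare4

/-! D-0027 §2.1 — DECIDING THEOREM (planner-authored via `route open/edit --closes-file`; by planner-decomp-sp4-writer-1-g2-0 2026-08-30T05:36:58Z):
its hypotheses are this route's items and its conclusion the sub-problem Statement (glue_lint), and it elaborates with this file. -/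

@[closes "route-SmoothPoincare4-RootDecompP"] theorem closes (h₁ : DissolveOne) (h₂ : DissolvableGluckReachable) (h₃ : GluckTwistOfGluckTwist)
    (h₄ : GluckTwistsStandard) : _root_.SmoothPoincare4 := by
  intro M _ _ _ _ _ e
  obtain ⟨S₀, S₁, ⟨d₀⟩, hd₁, hchain⟩ := h₂ M e (h₁ M e)
  have h0 : ∃ K : Literature.Topology.FourManifolds.TwoKnot,
      Literature.Topology.FourManifolds.IsGluckTwist (𝓡 4) S₀.carrier K := by
    obtain ⟨ν, hν⟩ := (Literature.Topology.FourManifolds.isGluckTwist_sphere_unknotTwo_holds :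
      Literature.Topology.FourManifolds.IsGluckTwist (𝓡 4) _ Literature.Topology.FourManifolds.unknotTwo)
    exact ⟨Literature.Topology.FourManifolds.unknotTwo, ν, hν.diffeomorph_comp_of_boundaryless d₀.symm⟩
  have h1 : ∃ K : Literature.Topology.FourManifolds.TwoKnot,
      Literature.Topology.FourManifolds.IsGluckTwist (𝓡 4) S₁.carrier K := by
    clear hd₁
    induction hchain with
    | refl => exact h0
    | tail _ hstep ih => exact h₃ _ _ ih hstep
  obtain ⟨d₁⟩ := hd₁
  obtain ⟨K, νK, hK⟩ := h1
  exact h₄ K M ⟨νK, hK.diffeomorph_comp_of_boundaryless d₁⟩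

end Summit.SmoothPoincare4.SmoothPoincare4.Theses.RootDecompP
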